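import Literature.Computability.AlgebraicComplexity.GroupTheoreticMatMul
import Mathlib.Algebra.Group.Pointwise.Finset.Basic
import Mathlib.Data.Fintype.Pi
import HarnessLib

/-!
# `H`-charts, local Chart-USPs and the STPP families they generate (Cohn–Kleinberg–Szegedy–Umans, Thm. 37)

Topic `Computability/AlgebraicComplexity`, namespace `Literature.Computability.AlgebraicComplexity`.

H. Cohn, R. Kleinberg, B. Szegedy, C. Umans, *Group-theoretic algorithms for matrix multiplication*,
FOCS 2005, arXiv:math/0511460 (held corpus text `paper:arxiv-math_0511460`, §6.2, chunk p0011), over the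
tree's simultaneous triple product property `IsSTPP` (`GroupTheoreticMatMul.lean`, CKSU Def. 5.1 in
additive form).

* `IsHChart A B C` — **Definition 36** (p. 11): "Let `H` be a finite abelian group. An `H`-chart
  `𝒞 = (Γ, A, B, C)` consists of a finite set of symbols `Γ`, together with three mappings
  `A, B, C : Γ → 2^H` such that for each `x ∈ Γ`, the sets `A(x), B(x), C(x)` satisfy the triple product
  property." (Here `A B C : Γ → Finset H`; finiteness of `Γ`, `H` is not needed for Thm. 37 and not
  assumed; the TPP of a single triple is spelled out in the additive form of `IsSTPP`.)
* `chartHypergraph A B C ⊆ Γ³` — Def. 36: "the set of ordered triples `(x, y, z)` such that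
  `0 ∉ A(x) − A(y) + B(y) − B(z) + C(z) − C(x)`" (pointwise `Finset` sums and differences).
* `IsLocalChartUSP A B C row` — Def. 36: "A local `𝒞`-USP of width `k` is a subset `U ⊆ Γ^k` such that
  for each ordered triple `(u, v, w) ∈ U³`, with `u, v, w` not all equal, there exists `i ∈ [k]` such that
  `(uᵢ, vᵢ, wᵢ) ∈ H(𝒞)`", rendered — as `IsLocalStrongUSP` of `LocalStrongUSP.lean` — for a FAMILY of rows
  `row : Fin L → Fin n → Γ` with "not all equal" on the indices (for an injective family this is
  literally the printed condition on the set of rows; in general it is the printed condition plus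
  injectivity, which the conclusion needs anyway).
* `isSTPP_piFinset_of_chartUSP` — **Theorem 37 in the tree's threading of `IsSTPP`** (verbatim the
  shared stub `stub_chartSTPP` of the crux lines on `stmt-MatrixMultiplication-10596`,
  `Cruxes/BoundedExponentThird/Lines/gibbs-partition-charts.lean`): symbol TPP plus, for every index
  triple `(i, j, k)` not all equal, a coordinate `c` with
  `0 ∉ (A(row i c) − A(row k c)) + (B(row j c) − B(row i c)) + (C(row k c) − C(row j c))` — this is the
  hypergraph condition of Def. 36 for the rotated symbol triple `(row k c, row i c, row j c)` up to the
  sign of the whole set, i.e. exactly the relation set of `IsSTPP` at `(i, j, k)` — give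
  `IsSTPP (∏_c A(row · c)) (∏_c B(row · c)) (∏_c C(row · c))` (blocks `Fintype.piFinset`), PROVED;
* `CohnKleinbergSzegedyUmans2005_thm37` — **Theorem 37 AS PRINTED** (p. 11): "Let `H` be a finite abelian
  group, `𝒞` an `H`-chart, and `U` a local `𝒞`-USP of width `k`. For each `u ∈ U` define subsets
  `A_u, B_u, C_u ⊆ H^k` by `A_u = ∏ᵢ A(uᵢ)`, `B_u = ∏ᵢ B(uᵢ)`, `C_u = ∏ᵢ C(uᵢ)`. Then these triples of
  subsets satisfy the simultaneous triple product property." — PROVED from the previous theorem by the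
  rotation `(i, j, k) ↦ (k, i, j)` of the index triple and `0 ∈ S ↔ 0 ∈ −S`.

Printed proof idea (the paper defers it to the full version; it is the proof of Thm. 33 =
`CohnKleinbergSzegedyUmans2005_thm33_holds` with "exactly one nonzero term" replaced by the hypergraph
hypothesis): an STPP relation `(s' − s) + (t' − t) + (u' − u) = 0` between the blocks of rows `i, j, k`
holds coordinatewise, exhibiting `0` in the relation set of every coordinate; if the indices are not all
equal this contradicts the local Chart-USP coordinate; if `i = j = k` the symbol TPP at each coordinate
gives `s = s'`, `t = t'`, `u = u'`. Theorem 33 (local strong USPs over the `Cyc_ℓ`-chart with three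
symbols, `LocalStrongUSP.lean`) is the special case `Γ = {1, 2, 3}` of the example after Def. 36.
-/

namespace Literature.Computability.AlgebraicComplexity

open Finset
open scoped Pointwise

variable {H Γ : Type*} [AddCommGroup H] [DecidableEq H]

/-- **`H`-chart** (CKSU Def. 36): symbols `Γ` with `A, B, C : Γ → 2^H` such that every
`(A x, B x, C x)` has the triple product property — in the additive form of the tree's `IsSTPP`:
`(a' − a) + (b' − b) + (c' − c) = 0` with `a, a' ∈ A x`, `b, b' ∈ B x`, `c, c' ∈ C x` forces
`a = a'`, `b = b'`, `c = c'`. [cite: CohnKleinbergSzegedyUmans2005, Def. 36 (p. 11)] -/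
def IsHChart (A B C : Γ → Finset H) : Prop :=
  ∀ x : Γ, ∀ a ∈ A x, ∀ a' ∈ A x, ∀ b ∈ B x, ∀ b' ∈ B x, ∀ c ∈ C x, ∀ c' ∈ C x,
    (a' - a) + (b' - b) + (c' - c) = 0 → a = a' ∧ b = b' ∧ c = c'

/-- **The hypergraph `H(𝒞) ⊆ Γ³` of a chart** (CKSU Def. 36): the ordered symbol triples `(x, y, z)` with
`0 ∉ A(x) − A(y) + B(y) − B(z) + C(z) − C(x)` (pointwise set operations in `H`).
[cite: CohnKleinbergSzegedyUmans2005, Def. 36 (p. 11)] -/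
def chartHypergraph (A B C : Γ → Finset H) : Set (Γ × Γ × Γ) :=
  {p | (0 : H) ∉ (A p.1 - A p.2.1) + (B p.2.1 - B p.2.2) + (C p.2.2 - C p.1)}

/-- Membership in the chart hypergraph, unfolded. [cite: CohnKleinbergSzegedyUmans2005, Def. 36 (p. 11)] -/
theorem mem_chartHypergraph_iff (A B C : Γ → Finset H) (x y z : Γ) :
    (x, y, z) ∈ chartHypergraph A B C ↔ (0 : H) ∉ (A x - A y) + (B y - B z) + (C z - C x) :=
  Iff.rfl

/-- **Local `𝒞`-USP of width `n`** (CKSU Def. 36), as a family of `L` rows `row : Fin L → Fin n → Γ`: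
every ordered index triple `(u, v, w)` not all equal has a coordinate `c` with
`(row u c, row v c, row w c) ∈ H(𝒞)`. [cite: CohnKleinbergSzegedyUmans2005, Def. 36 (p. 11)] -/
def IsLocalChartUSP (A B C : Γ → Finset H) {n L : ℕ} (row : Fin L → Fin n → Γ) : Prop :=
  ∀ u v w : Fin L, ¬ (u = v ∧ v = w) → ∃ c : Fin n, (row u c, row v c, row w c) ∈ chartHypergraph A B C

/-- The product block `∏_c S(row i c) ⊆ H^n` of a row (CKSU Thm. 37: `A_u = ∏ᵢ A(uᵢ)`), as a `Finset` of
functions (`Fintype.piFinset`). [cite: CohnKleinbergSzegedyUmans2005, Thm. 37 (p. 11)] -/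
abbrev chartBlock (S : Γ → Finset H) {n L : ℕ} (row : Fin L → Fin n → Γ) (i : Fin L) :
    Finset (Fin n → H) :=
  Fintype.piFinset fun c => S (row i c)

/-- **CKSU Theorem 37 in the tree's threading of `IsSTPP`**: over symbols with the triple product property
(`IsHChart`, spelled out), a family of rows in which every index triple `(i, j, k)` not all equal has a
coordinate `c` with `0 ∉ (A(row i c) − A(row k c)) + (B(row j c) − B(row i c)) + (C(row k c) − C(row j c))`
(the relation set of `IsSTPP` at `(i, j, k)`; the hypergraph condition of Def. 36 for the symbol triple
`(row k c, row i c, row j c)` up to sign) yields an `IsSTPP` family of product blocks in `Fin n → H`. This is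
verbatim the stub `stub_chartSTPP` shared by the crux lines on `stmt-MatrixMultiplication-10596`.
[cite: CohnKleinbergSzegedyUmans2005, Def. 36 and Thm. 37 (p. 11)] -/
theorem isSTPP_piFinset_of_chartUSP (A B C : Γ → Finset H)
    (hTPP : ∀ x : Γ, ∀ a ∈ A x, ∀ a' ∈ A x, ∀ b ∈ B x, ∀ b' ∈ B x, ∀ c ∈ C x, ∀ c' ∈ C x,
      (a' - a) + (b' - b) + (c' - c) = 0 → a = a' ∧ b = b' ∧ c = c')
    {n L : ℕ} (row : Fin L → Fin n → Γ)
    (husp : ∀ i j k : Fin L, ¬ (i = j ∧ j = k) → ∃ c : Fin n,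
      (0 : H) ∉ (A (row i c) - A (row k c)) + (B (row j c) - B (row i c)) +
        (C (row k c) - C (row j c))) :
    IsSTPP (fun i => Fintype.piFinset fun c => A (row i c))
      (fun i => Fintype.piFinset fun c => B (row i c))
      (fun i => Fintype.piFinset fun c => C (row i c)) := by
  intro i j k s hs s' hs' t ht t' ht' u hu u' hu' hsum
  rw [Fintype.mem_piFinset] at hs hs' ht ht' hu hu'
  -- the relation, coordinate by coordinate
  have hc : ∀ c : Fin n, s' c - s c + (t' c - t c) + (u' c - u c) = 0 := fun c => by
    have e := congrFun hsum c
    simpa only [Pi.add_apply, Pi.sub_apply, Pi.zero_apply] using e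
  -- (1) simultaneity: the indices are all equal (else a local Chart-USP coordinate is violated)
  have hijk : i = j ∧ j = k := by
    by_contra hne
    obtain ⟨c, hpat⟩ := husp i j k hne
    refine hpat ?_
    rw [← hc c]
    exact Finset.add_mem_add (Finset.add_mem_add (Finset.sub_mem_sub (hs' c) (hs c))
      (Finset.sub_mem_sub (ht' c) (ht c))) (Finset.sub_mem_sub (hu' c) (hu c))
  -- (2) the triple product property of the single triple of blocks, from the symbol TPP coordinatewise
  obtain ⟨hij, hjk⟩ := hijk
  subst hjk
  subst hij
  have key : ∀ c : Fin n, s c = s' c ∧ t c = t' c ∧ u c = u' c := fun c =>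
    hTPP (row i c) (s c) (hs c) (s' c) (hs' c) (t c) (ht c) (t' c) (ht' c) (u c) (hu c) (u' c)
      (hu' c) (hc c)
  exact ⟨rfl, rfl, funext fun c => (key c).1, funext fun c => (key c).2.1,
    funext fun c => (key c).2.2⟩

/-- **Cohn–Kleinberg–Szegedy–Umans 2005, Theorem 37** (AS PRINTED, p. 11): "Let `H` be a finite abelian
group, `𝒞` an `H`-chart, and `U` a local `𝒞`-USP of width `k`. For each `u ∈ U` define subsets
`A_u, B_u, C_u ⊆ H^k` by `A_u = ∏ᵢ A(uᵢ)`, `B_u = ∏ᵢ B(uᵢ)`, `C_u = ∏ᵢ C(uᵢ)`. Then these triples of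
subsets satisfy the simultaneous triple product property." — for an `H`-chart (`IsHChart`) and a local
`𝒞`-USP of `L` rows (`IsLocalChartUSP`), the family of product blocks (`chartBlock`) is an STPP
construction (`IsSTPP`, CKSU Def. 5.1 in the tree's additive form) in `Fin n → H`; finiteness of `H` is not
needed. Proved (from `isSTPP_piFinset_of_chartUSP` by rotating the index triple).
[cite: CohnKleinbergSzegedyUmans2005, Thm. 37 (p. 11)] -/
theorem CohnKleinbergSzegedyUmans2005_thm37 {A B C : Γ → Finset H} (hChart : IsHChart A B C)
    {n L : ℕ} {row : Fin L → Fin n → Γ} (hU : IsLocalChartUSP A B C row) :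
    IsSTPP (chartBlock A row) (chartBlock B row) (chartBlock C row) := by
  refine isSTPP_piFinset_of_chartUSP A B C hChart row fun i j k hne => ?_
  -- the local Chart-USP coordinate of the rotated index triple `(k, i, j)`
  obtain ⟨c, hpat⟩ := hU k i j fun h => hne ⟨h.2, h.2.symm.trans h.1.symm⟩
  rw [mem_chartHypergraph_iff] at hpat
  refine ⟨c, fun h0 => hpat ?_⟩
  -- `0 ∈ S ↔ 0 ∈ -S`, and `-((A i − A k) + (B j − B i) + (C k − C j))` is the hypergraph set
  have hneg : (0 : H) ∈ -((A (row i c) - A (row k c)) + (B (row j c) - B (row i c)) +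
      (C (row k c) - C (row j c))) :=
    Finset.mem_neg.2 ⟨0, h0, neg_zero⟩
  simpa only [neg_add_rev, neg_sub, add_comm, add_left_comm, add_assoc] using hneg

end Literature.Computability.AlgebraicComplexity
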